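import Summits.BirchSwinnertonDyer.BirchSwinnertonDyer.Theorems.CyclotomicUntwistKSepGlueOfGZK
import Summits.BirchSwinnertonDyer.BirchSwinnertonDyer.Theorems.CyclotomicUntwistC1OfPrintByName
import HarnessLib

/-!
# Crux K2 `PSRankOneUpperHalfAtThree` ⟸ ITS TWO RESEARCH CHILDREN + SIX NAMED PRINT FACTS, BY NAME — a CONDITIONAL result
# (lead bsd-line-cycu-p1 g8; ledger bookkeeping after the print layer (T) landed)

Cell `pub/bsd-wall` (D-0145 line `route-BirchSwinnertonDyer-CyclotomicUntwist`), seat `bsd-line-cycu-p1` (K1/K2 LEAD lineage,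
gen 8). THEOREMS ONLY (no definition, no new named fact, no `sorry`). BSD is not proved by this file and the crux
`PSRankOneUpperHalfAtThree` (stmt-BirchSwinnertonDyer-21581) is NOT closed by it: the theorem is CONDITIONAL on the two RESEARCH
children of the K-SEP split — `PSGrossZagierDescendedEigenlineAtThree` (C4, stmt-BirchSwinnertonDyer-27546) and
`PSpAdicBSDKatoSideDescendedEigenlineAtThree` (C5≤ stmt-BirchSwinnertonDyer-27592), open route items taken as hypotheses — and on six named print facts
(`nonempty_modularParametrizationData`, `IsNewformOf.level_eq_conductorNorm`, `GrossZagier1986_thm_I_7_3`, `PublishedInputGZK`,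
`Hida2000_thm326_exists_galoisRep`, `Carayol1986_eulerFactor`). It composes the K-SEP glue
`CyclotomicUntwistKSepGlueOfGZK.psRankOneUpperHalfAtThree_of_gzk_of_research` (K2 ⟸ GZK + C1 + C4 + C5) with the by-name C1 closer
`PSC1OfPrint.psUntwistedLFunctionAtThree_of_print` (p651954: C1 ⟸ the six print facts; underneath: the uniform root law
p650112, cycu-p4 g12's Γ₁ glue p649627, cycu-p3 g10's wildness p650778), so that the ledger reads: **K2 hinges on exactly
{C4, C5≤} + print** (the registered line v8, `Cruxes/PSRankOneUpperHalfAtThree/Lines`, says the same with stubs).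

References: [cite: MazurTateTeitelbaum1986Invent, §I.14] · [cite: CarayolASENS1986, Thm. (A)] · [cite: GrossZagier1986, Thm. I.(7.3)]
· [cite: Kobayashi2013, Cor. 1.3].
-/

noncomputable section

open Literature.NumberTheory.EllipticCurves Literature.NumberTheory.EllipticCurves.ModularForms
  Summit.BirchSwinnertonDyer.BirchSwinnertonDyer.Theses.CyclotomicUntwist

-- single-conjunct summit: `Summit.BirchSwinnertonDyer.BirchSwinnertonDyer.…` repeats the name by design
set_option linter.dupNamespace false
set_option autoImplicit false

namespace Summit.BirchSwinnertonDyer.BirchSwinnertonDyer.Theorems.PSRankOneHalvesOfCruxes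

/-- **`PSRankOneUpperHalfAtThree` ⟸ C4 + C5≤ + six named print facts (CONDITIONAL; nothing here asserts C4 or C5).**
[cite: MazurTateTeitelbaum1986Invent, §I.14] [cite: CarayolASENS1986, Thm. (A)] [cite: GrossZagier1986, Thm. I.(7.3)] -/
theorem psRankOneUpperHalfAtThree_of_cruxes_of_print
    (hC4 : PSGrossZagierDescendedEigenlineAtThree) (hC5 : PSpAdicBSDKatoSideDescendedEigenlineAtThree)
    (hmod : nonempty_modularParametrizationData)
    (hlev : ∀ (N : ℕ) [NeZero N], IsNewformOf.level_eq_conductorNorm (N := N))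
    (hGZ86 : GrossZagier1986_thm_I_7_3) (hGZK : PublishedInputGZK)
    (hD : Hida2000_thm326_exists_galoisRep) (hCar : Carayol1986_eulerFactor) :
    PSRankOneUpperHalfAtThree :=
  CyclotomicUntwistKSepGlueOfGZK.psRankOneUpperHalfAtThree_of_gzk_of_research hGZK
    (PSC1OfPrint.psUntwistedLFunctionAtThree_of_print hmod hlev hGZ86 hGZK hD hCar) hC4 hC5

end Summit.BirchSwinnertonDyer.BirchSwinnertonDyer.Theorems.PSRankOneHalvesOfCruxes

end
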